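import Literature.Computability.QuantumComplexity.BravyiGossetPairData
import HarnessLib

/-!
# Second and fourth moments of equatorial test states (norm estimation)

Topic `Literature/Computability/QuantumComplexity`, sub-namespace `BravyiGosset`, fourth file
towards `BravyiGosset2016_estimateAcceptProb_holds`.

Bravyi–Gosset estimate `‖ψ‖²` of a vector given as a sum of `χ` stabilizer states from the
statistics of `|⟨θ|ψ⟩|²` for random stabilizer states `θ`, using that these form a `2`-design:
`E|⟨θ|ψ⟩|² = ‖ψ‖²/d`, `E|⟨θ|ψ⟩|⁴ = 2‖ψ‖⁴/(d(d+1))` (2016, §II eq. (14)–(16), Lemma 2). The same two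
moments — which is all Chebyshev's inequality consumes — hold for the much smaller family of
**equatorial** test states `θ_β(z) = 2^{-N/2} (−1)^{z·R z} i^{ρ·z}` (`R` strictly upper triangular
over `𝔽₂`, `ρ ∈ ℤ₄^N`, read off a block `β` of `N² + 2N` fair coins; Bravyi et al. 2019, §4.1,
use random equatorial states for norm estimation). Writing `T_β(Φ) = Σ_z θ̄-phase_β(z) Φ(z)`
(`testSum`; `⟨θ_β|Φ⟩ = 2^{-N/2} T_β(Φ)`), this file proves, for every `Φ : 𝔽₂^N → ℂ`,

* `sum_fourPhase` — the character sum behind both moments: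
  `Σ_β c̄_β(z₁) c_β(z₂) c̄_β(z₃) c_β(z₄) = 2^{N²+2N} · [(z₁ = z₂ ∧ z₃ = z₄) ∨ (z₁ = z₄ ∧ z₂ = z₃)]`
  (per coin: an `R`-bit gives `1 + (−1)^{Σ_i z_i,j z_i,j'}`, the two bits of `ρ_j` give
  `(1 + i^{−m_j})(1 + (−1)^{m_j})`, `m_j = z₁,j − z₂,j + z₃,j − z₄,j`; the combinatorial lemma
  `pairCond_iff` identifies the surviving `4`-tuples);
* **`sum_normSq_testSum`**: `Σ_β |T_β(Φ)|² = 2^{N²+2N} Σ_z |Φ(z)|²` (exact, unbiased);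
* **`sum_normSq_sq_testSum_le`**: `Σ_β |T_β(Φ)|⁴ ≤ 2^{N²+2N} · 2 (Σ_z |Φ(z)|²)²`
  (in fact `= 2^{N²+2N}(2‖Φ‖₂⁴ − ‖Φ‖₄⁴)`, `sum_normSq_sq_testSum_eq`).

## References

* S. Bravyi, D. Gosset, *Improved classical simulation of quantum circuits dominated by Clifford
  gates*, Phys. Rev. Lett. 116 (2016) 250501, arXiv:1601.07601v3, §II eq. (14)–(16) and Lemma 2
  (norm estimation from the second and fourth moments of random stabilizer overlaps).
* S. Bravyi, D. Browne, P. Calpin, E. Campbell, D. Gosset, M. Howard, *Simulation of quantum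
  circuits by low-rank stabilizer decompositions*, Quantum 3 (2019) 181, arXiv:1808.00128, §4.1
  (equatorial stabilizer states in norm estimation).
-/

noncomputable section

namespace Literature.Computability.QuantumComplexity.BravyiGosset

open Complex Finset _root_.Computability Literature.Computability.Cryptography

/-! ### Products over ranges -/

/-- `Π_{p<n} f(2p) f(2p+1) = Π_{k<2n} f(k)`. [folklore] -/
theorem prod_range_pairs {M : Type*} [CommMonoid M] (f : ℕ → M) (n : ℕ) :
    ∏ p ∈ range n, (f (2 * p) * f (2 * p + 1)) = ∏ k ∈ range (2 * n), f k := by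
  induction n with
  | zero => simp
  | succ n ih =>
    rw [Finset.prod_range_succ, ih, show 2 * (n + 1) = 2 * n + 1 + 1 by ring, Finset.prod_range_succ,
      Finset.prod_range_succ, mul_assoc]

/-- `Π_{q < n·m} f(q) = Π_{a<n} Π_{b<m} f(a m + b)`. [folklore] -/
theorem prod_range_mul {M : Type*} [CommMonoid M] (f : ℕ → M) (n m : ℕ) :
    ∏ q ∈ range (n * m), f q = ∏ a ∈ range n, ∏ b ∈ range m, f (a * m + b) := by
  induction n with
  | zero => simp
  | succ n ih => rw [Nat.succ_mul, Finset.prod_range_add, ih, Finset.prod_range_succ]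

/-- `Σ_{q < n·m} f(q) = Σ_{a<n} Σ_{b<m} f(a m + b)`. [folklore] -/
theorem sum_range_mul {M : Type*} [AddCommMonoid M] (f : ℕ → M) (n m : ℕ) :
    ∑ q ∈ range (n * m), f q = ∑ a ∈ range n, ∑ b ∈ range m, f (a * m + b) := by
  induction n with
  | zero => simp
  | succ n ih => rw [Nat.succ_mul, Finset.sum_range_add, ih, Finset.sum_range_succ]

/-- A product of indicator factors is the indicator of the conjunction. [folklore] -/
theorem prod_ite_one_zero {ι : Type*} (s : Finset ι) (P : ι → Prop) [DecidablePred P] :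
    ∏ i ∈ s, (if P i then (1 : ℂ) else 0) = if ∀ i ∈ s, P i then 1 else 0 := by
  classical
  induction s using Finset.induction_on with
  | empty => simp
  | insert a s ha ih =>
    rw [Finset.prod_insert ha, ih]
    by_cases hPa : P a
    · simp [hPa]
    · simp [hPa]

/-! ### The test phase and its conjugate, coin by coin -/

variable {N : ℕ}

/-- The conjugate test phase of the block `β`, `c̄_β(z) = (−1)^{z·Rz} i^{κ·z}`, at a label.
[cite: BravyiEtAl2019, §4.1] -/
def cc (β : Fin (blockLen N) → Bool) (z : QReg N) : ℂ := ccPhase N (wbit β) z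

/-- `star (i^n) = i^{3n}`. [folklore] -/
theorem star_I_pow (n : ℕ) : star (I ^ n) = I ^ (3 * n) := by
  rw [star_pow, Complex.star_def, Complex.conj_I, pow_mul]
  congr 1
  rw [pow_succ, pow_two, Complex.I_mul_I]; ring

/-- `star ((−1)^n) = (−1)^n`. [folklore] -/
theorem star_neg_one_pow (n : ℕ) : star ((-1 : ℂ) ^ n) = (-1 : ℂ) ^ n := by
  rw [star_pow, star_neg, star_one]

/-- The four bits of column `j` weighted `1, 3, 1, 3`: `m_j = [z₁ⱼ] + 3[z₂ⱼ] + [z₃ⱼ] + 3[z₄ⱼ]`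
(`≡ z₁ⱼ − z₂ⱼ + z₃ⱼ − z₄ⱼ mod 4`). [folklore] -/
def colM (z₁ z₂ z₃ z₄ : QReg N) (j : ℕ) : ℕ :=
  Bool.toNat (wbit z₁ j) + 3 * Bool.toNat (wbit z₂ j) + Bool.toNat (wbit z₃ j) + 3 * Bool.toNat (wbit z₄ j)

/-- The pair count `e_{jj'} = Σ_i [z_i,j][z_i,j']`. [folklore] -/
def colE (z₁ z₂ z₃ z₄ : QReg N) (j j' : ℕ) : ℕ :=
  Bool.toNat (wbit z₁ j && wbit z₁ j') + Bool.toNat (wbit z₂ j && wbit z₂ j') +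
    Bool.toNat (wbit z₃ j && wbit z₃ j') + Bool.toNat (wbit z₄ j && wbit z₄ j')

/-- The one-coin factors of the four-phase product: position `q < N²` is the `R`-bit `(j', j)`,
`q = j' N + j` (unused when `j ≥ j'`); position `N² + 2j` (`+1`) is the low (high) bit of `ρ_j`.
[folklore] -/
def coinFactor (z₁ z₂ z₃ z₄ : QReg N) (q : ℕ) (b : Bool) : ℂ :=
  if q < N * N then
    (if q % N < q / N then (-1 : ℂ) ^ (Bool.toNat b * colE z₁ z₂ z₃ z₄ (q % N) (q / N)) else 1)
  else if (q - N * N) % 2 = 0 then I ^ (3 * Bool.toNat b * colM z₁ z₂ z₃ z₄ ((q - N * N) / 2))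
  else I ^ (2 * Bool.toNat b * colM z₁ z₂ z₃ z₄ ((q - N * N) / 2))

/-- The product of four (conjugate) test phases. [folklore] -/
def fourPhase (β : Fin (blockLen N) → Bool) (z₁ z₂ z₃ z₄ : QReg N) : ℂ :=
  cc β z₁ * star (cc β z₂) * cc β z₃ * star (cc β z₄)

/-- `κ_j m ≡ 3 b₀ m + 2 b₁ m (mod 4)` for `κ_j = −ρ_j`, `ρ_j = b₀ + 2 b₁`. [folklore] -/
theorem kapAt_mul_mod (β : ℕ → Bool) (j m : ℕ) :
    (kapAt N β j * m) % 4 =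
      (3 * Bool.toNat (β (idxRho0 N j)) * m + 2 * Bool.toNat (β (idxRho1 N j)) * m) % 4 := by
  unfold kapAt rhoAt
  cases β (idxRho0 N j)
  · cases β (idxRho1 N j)
    · simp
    · simp
  · cases β (idxRho1 N j)
    · simp
    · simp only [Bool.toNat_true, mul_one]
      omega

/-- Signs of a strictly triangular double sum as a product over the square. [folklore] -/
theorem neg_one_pow_sum_sum_eq_prod (n : ℕ) (t : ℕ → ℕ → ℕ) :
    (-1 : ℂ) ^ (∑ j' ∈ range n, ∑ j ∈ range j', t j j') =
      ∏ a ∈ range n, ∏ b ∈ range n, if b < a then (-1 : ℂ) ^ t b a else 1 := by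
  rw [← Finset.prod_pow_eq_pow_sum]
  refine Finset.prod_congr rfl fun a ha => ?_
  have haN := (Finset.mem_range.1 ha).le
  rw [← Finset.prod_pow_eq_pow_sum, ← Finset.prod_range_mul_prod_Ico _ haN,
    Finset.prod_eq_one (s := Finset.Ico a n) (fun b hb => if_neg (Nat.not_lt.2 (Finset.mem_Ico.1 hb).1)),
    mul_one]
  exact Finset.prod_congr rfl fun b hb => (if_pos (Finset.mem_range.1 hb)).symm

/-- Splitting a product over a sample block into the `R`-square and the `ρ`-pairs. [folklore] -/
theorem prod_range_blockLen {M : Type*} [CommMonoid M] (N : ℕ) (f : ℕ → M) :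
    ∏ q ∈ range (blockLen N), f q =
      (∏ a ∈ range N, ∏ b ∈ range N, f (a * N + b)) * ∏ j ∈ range N, (f (N * N + 2 * j) * f (N * N + 2 * j + 1)) := by
  unfold blockLen
  rw [Finset.prod_range_add, prod_range_mul, ← prod_range_pairs]
  rfl

/-- Division with remainder of an `R`-position. [folklore] -/
theorem divmod_R {a b : ℕ} (ha : a < N) (hb : b < N) :
    a * N + b < N * N ∧ (a * N + b) / N = a ∧ (a * N + b) % N = b := by
  have hN : 0 < N := by omega
  refine ⟨by nlinarith, ?_, ?_⟩
  · rw [Nat.add_comm, Nat.add_mul_div_right _ _ hN, Nat.div_eq_of_lt hb, Nat.zero_add]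
  · rw [Nat.add_comm, Nat.add_mul_mod_self_right, Nat.mod_eq_of_lt hb]

/-- The `R`-coin factor at position `(a, b)`. [folklore] -/
theorem coinFactor_R (z₁ z₂ z₃ z₄ : QReg N) {a b : ℕ} (ha : a < N) (hb : b < N) (c : Bool) :
    coinFactor z₁ z₂ z₃ z₄ (a * N + b) c =
      if b < a then (-1 : ℂ) ^ (Bool.toNat c * colE z₁ z₂ z₃ z₄ b a) else 1 := by
  obtain ⟨hlt, hdiv, hmod⟩ := divmod_R ha hb
  simp only [coinFactor, if_pos hlt, hdiv, hmod]

/-- The two `ρ`-coin factors of column `j`. [folklore] -/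
theorem coinFactor_rho (z₁ z₂ z₃ z₄ : QReg N) (j : ℕ) (c c' : Bool) :
    coinFactor z₁ z₂ z₃ z₄ (N * N + 2 * j) c * coinFactor z₁ z₂ z₃ z₄ (N * N + 2 * j + 1) c' =
      I ^ (3 * Bool.toNat c * colM z₁ z₂ z₃ z₄ j) * I ^ (2 * Bool.toNat c' * colM z₁ z₂ z₃ z₄ j) := by
  have h1 : ¬ (N * N + 2 * j < N * N) := by omega
  have h2 : ¬ (N * N + 2 * j + 1 < N * N) := by omega
  have h3 : (N * N + 2 * j - N * N) % 2 = 0 := by rw [Nat.add_sub_cancel_left]; omega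
  have h4 : ¬ ((N * N + 2 * j + 1 - N * N) % 2 = 0) := by rw [Nat.add_assoc, Nat.add_sub_cancel_left]; omega
  have h5 : (N * N + 2 * j - N * N) / 2 = j := by rw [Nat.add_sub_cancel_left]; omega
  have h6 : (N * N + 2 * j + 1 - N * N) / 2 = j := by rw [Nat.add_assoc, Nat.add_sub_cancel_left]; omega
  simp only [coinFactor, if_neg h1, if_neg h2, if_pos h3, if_neg h4, h5, h6]

/-- **The four-phase product coin by coin.** [folklore] -/
theorem fourPhase_eq_prod (β : Fin (blockLen N) → Bool) (z₁ z₂ z₃ z₄ : QReg N) :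
    fourPhase β z₁ z₂ z₃ z₄ = ∏ q ∈ range (blockLen N), coinFactor z₁ z₂ z₃ z₄ q (wbit β q) := by
  -- the right-hand side at the exponent level
  rw [prod_range_blockLen]
  rw [Finset.prod_congr rfl fun a ha => Finset.prod_congr rfl fun b hb =>
      coinFactor_R z₁ z₂ z₃ z₄ (Finset.mem_range.1 ha) (Finset.mem_range.1 hb) _,
    Finset.prod_congr rfl fun j _ => coinFactor_rho z₁ z₂ z₃ z₄ j _ _]
  rw [← neg_one_pow_sum_sum_eq_prod N (fun b a => Bool.toNat (wbit β (a * N + b)) * colE z₁ z₂ z₃ z₄ b a)]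
  have hI : ∏ j ∈ range N, (I ^ (3 * Bool.toNat (wbit β (N * N + 2 * j)) * colM z₁ z₂ z₃ z₄ j) *
      I ^ (2 * Bool.toNat (wbit β (N * N + 2 * j + 1)) * colM z₁ z₂ z₃ z₄ j)) =
      I ^ ∑ j ∈ range N, kapAt N (wbit β) j * colM z₁ z₂ z₃ z₄ j := by
    rw [← Finset.prod_pow_eq_pow_sum]
    refine Finset.prod_congr rfl fun j _ => ?_
    rw [← pow_add]
    exact (I_pow_eq_of_mod_eq (kapAt_mul_mod _ j _)).symm
  rw [hI]
  -- the left-hand side at the exponent level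
  have hcc : ∀ z : QReg N, cc β z = (-1 : ℂ) ^ quadR N (wbit β) z * I ^ linKap N (wbit β) z := fun _ => rfl
  have hst : ∀ z : QReg N, star (cc β z) = (-1 : ℂ) ^ quadR N (wbit β) z * I ^ (3 * linKap N (wbit β) z) := by
    intro z; rw [hcc, star_mul, star_neg_one_pow, star_I_pow, mul_comm]
  unfold fourPhase
  rw [hst, hst, hcc, hcc]
  rw [show ∀ a b c d e f g h : ℂ, a * e * (b * f) * (c * g) * (d * h) = (a * b * c * d) * (e * f * g * h)
    from fun _ _ _ _ _ _ _ _ => by ring]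
  simp only [← pow_add]
  congr 1
  · -- the signs: an identity of natural-number exponents
    congr 1
    unfold quadR idxR
    simp only [← Finset.sum_add_distrib]
    refine Finset.sum_congr rfl fun j' _ => Finset.sum_congr rfl fun j _ => ?_
    unfold colE
    cases wbit β (j' * N + j) <;> simp [toNat_and]
  · -- the `i`-powers: exponents agree modulo `4`
    apply I_pow_eq_of_mod_eq
    unfold linKap colM
    simp only [Finset.mul_sum, ← Finset.sum_add_distrib]
    apply sum_mod_congr
    intro j _
    ring_nf

/-! ### The character sum -/

/-- The pairing condition on four labels. [folklore] -/
def PairCond (z₁ z₂ z₃ z₄ : QReg N) : Prop := (z₁ = z₂ ∧ z₃ = z₄) ∨ (z₁ = z₄ ∧ z₂ = z₃)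

/-- The pairing condition is decidable. [folklore] -/
instance (z₁ z₂ z₃ z₄ : QReg N) : Decidable (PairCond z₁ z₂ z₃ z₄) := by
  unfold PairCond; infer_instance

/-- Summing one coin: an unused position gives `2`. [folklore] -/
theorem coinFactor_sum_unused (z₁ z₂ z₃ z₄ : QReg N) {a b : ℕ} (ha : a < N) (hb : b < N) (hab : ¬ b < a) :
    coinFactor z₁ z₂ z₃ z₄ (a * N + b) false + coinFactor z₁ z₂ z₃ z₄ (a * N + b) true = 2 := by
  rw [coinFactor_R _ _ _ _ ha hb, coinFactor_R _ _ _ _ ha hb, if_neg hab, if_neg hab]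
  norm_num

/-- Summing one coin: a used `R`-position gives `2·[e_{jj'} even]`. [folklore] -/
theorem coinFactor_sum_R (z₁ z₂ z₃ z₄ : QReg N) {a b : ℕ} (ha : a < N) (hb : b < N) (hab : b < a) :
    coinFactor z₁ z₂ z₃ z₄ (a * N + b) false + coinFactor z₁ z₂ z₃ z₄ (a * N + b) true =
      if colE z₁ z₂ z₃ z₄ b a % 2 = 0 then 2 else 0 := by
  rw [coinFactor_R _ _ _ _ ha hb, coinFactor_R _ _ _ _ ha hb, if_pos hab, if_pos hab]
  simp only [Bool.toNat_false, zero_mul, pow_zero, Bool.toNat_true, one_mul]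
  rw [neg_one_pow_eq_pow_mod_two]
  rcases Nat.mod_two_eq_zero_or_one (colE z₁ z₂ z₃ z₄ b a) with h | h <;> rw [h] <;> norm_num

/-- Summing the two coins of `ρ_j`: `(1 + i^{3m})(1 + (−1)^{m}) = 4·[m ≡ 0 (mod 4)]`. [folklore] -/
theorem coinFactor_sum_rho (z₁ z₂ z₃ z₄ : QReg N) (j : ℕ) :
    (coinFactor z₁ z₂ z₃ z₄ (N * N + 2 * j) false + coinFactor z₁ z₂ z₃ z₄ (N * N + 2 * j) true) *
      (coinFactor z₁ z₂ z₃ z₄ (N * N + 2 * j + 1) false + coinFactor z₁ z₂ z₃ z₄ (N * N + 2 * j + 1) true) =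
      if colM z₁ z₂ z₃ z₄ j % 4 = 0 then 4 else 0 := by
  rw [add_mul, mul_add, mul_add, coinFactor_rho, coinFactor_rho, coinFactor_rho, coinFactor_rho]
  simp only [Bool.toNat_false, mul_zero, zero_mul, pow_zero, Bool.toNat_true, mul_one, one_mul]
  set m := colM z₁ z₂ z₃ z₄ j
  rw [Complex.I_pow_eq_pow_mod (3 * m), Complex.I_pow_eq_pow_mod (2 * m)]
  have h4 : m % 4 = 0 ∨ m % 4 = 1 ∨ m % 4 = 2 ∨ m % 4 = 3 := by omega
  rcases h4 with h | h | h | h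
  · rw [show 3 * m % 4 = 0 by omega, show 2 * m % 4 = 0 by omega, if_pos h]; norm_num
  · rw [show 3 * m % 4 = 3 by omega, show 2 * m % 4 = 2 by omega, if_neg (by omega), Complex.I_sq]
    ring
  · rw [show 3 * m % 4 = 2 by omega, show 2 * m % 4 = 0 by omega, if_neg (by omega), Complex.I_sq]
    ring
  · rw [show 3 * m % 4 = 1 by omega, show 2 * m % 4 = 2 by omega, if_neg (by omega), pow_one, Complex.I_sq]
    ring

/-- Column `j` satisfies `m_j ≡ 0 (mod 4)` iff `[z₁ⱼ] + [z₃ⱼ] = [z₂ⱼ] + [z₄ⱼ]`. [folklore] -/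
theorem colM_mod_four_eq_zero_iff (z₁ z₂ z₃ z₄ : QReg N) (j : ℕ) :
    colM z₁ z₂ z₃ z₄ j % 4 = 0 ↔
      Bool.toNat (wbit z₁ j) + Bool.toNat (wbit z₃ j) = Bool.toNat (wbit z₂ j) + Bool.toNat (wbit z₄ j) := by
  unfold colM
  cases wbit z₁ j <;> cases wbit z₂ j <;> cases wbit z₃ j <;> cases wbit z₄ j <;> simp

/-- **The combinatorial lemma.** The column conditions — (C1) `[z₁ⱼ] + [z₃ⱼ] = [z₂ⱼ] + [z₄ⱼ]`
for all `j`, and (C2) `Σ_i [z_i,j][z_i,j']` even for all `j < j'` — hold iff the four labels pair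
up: `(z₁ = z₂ ∧ z₃ = z₄) ∨ (z₁ = z₄ ∧ z₂ = z₃)`. [folklore] -/
theorem pairCond_iff (z₁ z₂ z₃ z₄ : QReg N) :
    ((∀ j, j < N → Bool.toNat (wbit z₁ j) + Bool.toNat (wbit z₃ j) = Bool.toNat (wbit z₂ j) + Bool.toNat (wbit z₄ j)) ∧
      ∀ j', j' < N → ∀ j, j < j' → colE z₁ z₂ z₃ z₄ j j' % 2 = 0) ↔ PairCond z₁ z₂ z₃ z₄ := by
  constructor
  · rintro ⟨h1, h2⟩
    -- symmetric form of (C2)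
    have h2' : ∀ j j', j < N → j' < N → j ≠ j' → colE z₁ z₂ z₃ z₄ j j' % 2 = 0 := by
      intro j j' hj hj' hne
      rcases lt_or_gt_of_ne hne with h | h
      · exact h2 j' hj' j h
      · have := h2 j hj j' h
        unfold colE at this ⊢
        simpa [Bool.and_comm] using this
    by_cases hA : z₁ = z₂
    · left
      refine ⟨hA, funext fun j => ?_⟩
      have := h1 j j.2
      rw [hA] at this
      simp only [wbit_fin] at this
      revert this
      cases z₂ j <;> cases z₃ j <;> cases z₄ j <;> simp
    · right
      obtain ⟨j₀, hj₀⟩ : ∃ j₀ : Fin N, z₁ j₀ ≠ z₂ j₀ := Function.ne_iff.1 hA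
      have hc0 := h1 j₀ j₀.2
      simp only [wbit_fin] at hc0
      suffices key : ∀ j : Fin N, z₁ j = z₄ j ∧ z₂ j = z₃ j from
        ⟨funext fun j => (key j).1, funext fun j => (key j).2⟩
      intro j
      by_cases hjj : (j : ℕ) = j₀
      · have hj : j = j₀ := Fin.ext hjj
        subst hj
        revert hc0 hj₀
        cases z₁ j <;> cases z₂ j <;> cases z₃ j <;> cases z₄ j <;> simp
      · have hc := h1 j j.2
        have he := h2' j j₀ j.2 j₀.2 hjj
        simp only [wbit_fin] at hc
        unfold colE at he
        simp only [wbit_fin] at he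
        revert hc he hc0 hj₀
        cases z₁ j <;> cases z₂ j <;> cases z₃ j <;> cases z₄ j <;>
          cases z₁ j₀ <;> cases z₂ j₀ <;> cases z₃ j₀ <;> cases z₄ j₀ <;> simp
  · rintro (⟨rfl, rfl⟩ | ⟨rfl, rfl⟩)
    · refine ⟨fun j _ => by ring, fun j' _ j _ => ?_⟩
      unfold colE
      cases wbit z₁ j <;> cases wbit z₁ j' <;> cases wbit z₃ j <;> cases wbit z₃ j' <;> simp
    · refine ⟨fun j _ => by ring, fun j' _ j _ => ?_⟩
      unfold colE
      cases wbit z₁ j <;> cases wbit z₁ j' <;> cases wbit z₂ j <;> cases wbit z₂ j' <;> simp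

/-- **The character sum of the equatorial family**:
`Σ_β c̄_β(z₁) c_β(z₂) c̄_β(z₃) c_β(z₄) = 2^{N²+2N} · [(z₁ = z₂ ∧ z₃ = z₄) ∨ (z₁ = z₄ ∧ z₂ = z₃)]`.
[cite: BravyiEtAl2019, §4.1] -/
theorem sum_fourPhase (z₁ z₂ z₃ z₄ : QReg N) :
    ∑ β : Fin (blockLen N) → Bool, fourPhase β z₁ z₂ z₃ z₄ =
      if PairCond z₁ z₂ z₃ z₄ then 2 ^ blockLen N else 0 := by
  simp only [fourPhase_eq_prod]
  rw [sum_prod_wbit, prod_range_blockLen]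
  -- the `R`-square
  have hR : ∏ a ∈ range N, ∏ b ∈ range N,
      (coinFactor z₁ z₂ z₃ z₄ (a * N + b) false + coinFactor z₁ z₂ z₃ z₄ (a * N + b) true) =
      2 ^ (N * N) * if ∀ a ∈ range N, ∀ b ∈ range N, (b < a → colE z₁ z₂ z₃ z₄ b a % 2 = 0) then 1 else 0 := by
    have step : ∀ a ∈ range N, ∏ b ∈ range N,
        (coinFactor z₁ z₂ z₃ z₄ (a * N + b) false + coinFactor z₁ z₂ z₃ z₄ (a * N + b) true) =
        2 ^ N * ∏ b ∈ range N, (if (b < a → colE z₁ z₂ z₃ z₄ b a % 2 = 0) then (1 : ℂ) else 0) := by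
      intro a ha
      have haN := Finset.mem_range.1 ha
      have hfac : ∀ b ∈ range N,
          coinFactor z₁ z₂ z₃ z₄ (a * N + b) false + coinFactor z₁ z₂ z₃ z₄ (a * N + b) true =
          2 * (if (b < a → colE z₁ z₂ z₃ z₄ b a % 2 = 0) then (1 : ℂ) else 0) := by
        intro b hb
        have hbN := Finset.mem_range.1 hb
        by_cases hba : b < a
        · rw [coinFactor_sum_R _ _ _ _ haN hbN hba]
          by_cases he : colE z₁ z₂ z₃ z₄ b a % 2 = 0
          · rw [if_pos he, if_pos (fun _ => he)]; norm_num
          · rw [if_neg he, if_neg (fun h => he (h hba))]; norm_num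
        · rw [coinFactor_sum_unused _ _ _ _ haN hbN hba, if_pos (fun h => absurd h hba)]; norm_num
      rw [Finset.prod_congr rfl hfac, Finset.prod_mul_distrib, Finset.prod_const, Finset.card_range]
    rw [Finset.prod_congr rfl step, Finset.prod_mul_distrib, Finset.prod_const, Finset.card_range,
      ← pow_mul, Finset.prod_congr rfl fun a _ => prod_ite_one_zero (range N) _, prod_ite_one_zero]
  -- the `ρ`-pairs
  have hρ : ∏ j ∈ range N,
      ((coinFactor z₁ z₂ z₃ z₄ (N * N + 2 * j) false + coinFactor z₁ z₂ z₃ z₄ (N * N + 2 * j) true) *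
        (coinFactor z₁ z₂ z₃ z₄ (N * N + 2 * j + 1) false + coinFactor z₁ z₂ z₃ z₄ (N * N + 2 * j + 1) true)) =
      4 ^ N * if ∀ j ∈ range N, Bool.toNat (wbit z₁ j) + Bool.toNat (wbit z₃ j) =
        Bool.toNat (wbit z₂ j) + Bool.toNat (wbit z₄ j) then 1 else 0 := by
    have hfac : ∀ j ∈ range N,
        (coinFactor z₁ z₂ z₃ z₄ (N * N + 2 * j) false + coinFactor z₁ z₂ z₃ z₄ (N * N + 2 * j) true) *
          (coinFactor z₁ z₂ z₃ z₄ (N * N + 2 * j + 1) false + coinFactor z₁ z₂ z₃ z₄ (N * N + 2 * j + 1) true) =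
        4 * (if Bool.toNat (wbit z₁ j) + Bool.toNat (wbit z₃ j) = Bool.toNat (wbit z₂ j) + Bool.toNat (wbit z₄ j)
          then (1 : ℂ) else 0) := by
      intro j _
      rw [coinFactor_sum_rho]
      by_cases hc : colM z₁ z₂ z₃ z₄ j % 4 = 0
      · rw [if_pos hc, if_pos ((colM_mod_four_eq_zero_iff _ _ _ _ j).1 hc)]; norm_num
      · rw [if_neg hc, if_neg (fun h => hc ((colM_mod_four_eq_zero_iff _ _ _ _ j).2 h))]; norm_num
    rw [Finset.prod_congr rfl hfac, Finset.prod_mul_distrib, Finset.prod_const, Finset.card_range,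
      prod_ite_one_zero]
  rw [hR, hρ]
  rw [show ∀ (A B : ℂ) (P Q : Prop) [Decidable P] [Decidable Q],
      A * (if P then 1 else 0) * (B * (if Q then 1 else 0)) = if Q ∧ P then A * B else 0 from
    fun A B P Q _ _ => by by_cases hP : P <;> by_cases hQ : Q <;> simp [hP, hQ]]
  have hiff : ((∀ j ∈ range N, Bool.toNat (wbit z₁ j) + Bool.toNat (wbit z₃ j) =
        Bool.toNat (wbit z₂ j) + Bool.toNat (wbit z₄ j)) ∧
      ∀ a ∈ range N, ∀ b ∈ range N, (b < a → colE z₁ z₂ z₃ z₄ b a % 2 = 0)) ↔ PairCond z₁ z₂ z₃ z₄ := by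
    rw [← pairCond_iff]
    simp only [Finset.mem_range]
    constructor
    · rintro ⟨h1, h2⟩
      exact ⟨h1, fun j' hj' j hj => h2 j' hj' j (lt_trans hj hj') hj⟩
    · rintro ⟨h1, h2⟩
      exact ⟨h1, fun a ha b _ hba => h2 a ha b hba⟩
  rw [if_congr hiff rfl rfl]
  congr 1
  rw [show (4 : ℂ) = 2 ^ 2 by norm_num, ← pow_mul, ← pow_add]
  unfold blockLen
  ring

/-! ### The two moments -/

/-- The test sum `T_β(Φ) = Σ_z c̄_β(z) Φ(z)` (`= 2^{N/2} ⟨θ_β|Φ⟩`). [cite: BravyiEtAl2019, §4.1] -/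
def testSum (Φ : QReg N → ℂ) (β : Fin (blockLen N) → Bool) : ℂ := ∑ z : QReg N, cc β z * Φ z

/-- `c̄_β(0) = 1`: the zero label has trivial phase. [folklore] -/
theorem cc_zero (β : Fin (blockLen N) → Bool) : cc β (fun _ => false) = 1 := by
  unfold cc ccPhase quadR linKap
  have h0 : ∀ j, wbit (fun _ : Fin N => false) j = false := fun j => by
    unfold wbit; split <;> rfl
  simp [h0]

/-- `|T_β|² T̄…` expanded: `(T_β T̄_β)² = Σ_{z₁ z₂ z₃ z₄} (four phases) Φ(z₁) Φ̄(z₂) Φ(z₃) Φ̄(z₄)`.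
[folklore] -/
theorem testSum_mul_star_sq (Φ : QReg N → ℂ) (β : Fin (blockLen N) → Bool) :
    (testSum Φ β * star (testSum Φ β)) ^ 2 =
      ∑ z₁ : QReg N, ∑ z₂ : QReg N, ∑ z₃ : QReg N, ∑ z₄ : QReg N,
        fourPhase β z₁ z₂ z₃ z₄ * (Φ z₁ * star (Φ z₂) * Φ z₃ * star (Φ z₄)) := by
  unfold testSum fourPhase
  rw [star_sum, Finset.sum_mul_sum, pow_two]
  simp only [Finset.sum_mul, Finset.mul_sum]
  refine Finset.sum_congr rfl fun z₁ _ => Finset.sum_congr rfl fun z₂ _ =>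
    Finset.sum_congr rfl fun z₃ _ => Finset.sum_congr rfl fun z₄ _ => ?_
  rw [star_mul, star_mul]
  ring

/-- **Fourth moment, exactly**: `Σ_β (T_β T̄_β)² = 2^{N²+2N} (2 (Σ_z Φ Φ̄)² − Σ_z (Φ Φ̄)²)` in `ℂ`.
[cite: BravyiGosset2016, §II eq. (14) (fourth moment of the overlap)] -/
theorem sum_testSum_mul_star_sq (Φ : QReg N → ℂ) :
    ∑ β : Fin (blockLen N) → Bool, (testSum Φ β * star (testSum Φ β)) ^ 2 =
      2 ^ blockLen N * (2 * (∑ z : QReg N, Φ z * star (Φ z)) ^ 2 - ∑ z : QReg N, (Φ z * star (Φ z)) ^ 2) := by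
  simp only [testSum_mul_star_sq]
  rw [Finset.sum_comm]
  simp only [Finset.sum_comm (s := (Finset.univ : Finset (Fin (blockLen N) → Bool)))]
  simp only [← Finset.sum_mul, sum_fourPhase]
  -- inclusion–exclusion on the pairing condition
  have hsplit : ∀ z₁ z₂ z₃ z₄ : QReg N,
      (if PairCond z₁ z₂ z₃ z₄ then (2 : ℂ) ^ blockLen N else 0) * (Φ z₁ * star (Φ z₂) * Φ z₃ * star (Φ z₄)) =
      2 ^ blockLen N * ((if z₁ = z₂ ∧ z₃ = z₄ then Φ z₁ * star (Φ z₂) * Φ z₃ * star (Φ z₄) else 0) +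
        (if z₁ = z₄ ∧ z₂ = z₃ then Φ z₁ * star (Φ z₂) * Φ z₃ * star (Φ z₄) else 0) -
        (if z₁ = z₂ ∧ z₃ = z₄ ∧ z₁ = z₃ then Φ z₁ * star (Φ z₂) * Φ z₃ * star (Φ z₄) else 0)) := by
    intro z₁ z₂ z₃ z₄
    unfold PairCond
    by_cases hA : z₁ = z₂ ∧ z₃ = z₄ <;> by_cases hB : z₁ = z₄ ∧ z₂ = z₃
    · have hC : z₁ = z₂ ∧ z₃ = z₄ ∧ z₁ = z₃ := ⟨hA.1, hA.2, hA.1.trans hB.2⟩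
      rw [if_pos (Or.inl hA), if_pos hA, if_pos hB, if_pos hC]
      ring
    · have hC : ¬ (z₁ = z₂ ∧ z₃ = z₄ ∧ z₁ = z₃) := fun h => hB ⟨h.2.2.trans h.2.1, h.1.symm.trans h.2.2⟩
      rw [if_pos (Or.inl hA), if_pos hA, if_neg hB, if_neg hC]
      ring
    · have hC : ¬ (z₁ = z₂ ∧ z₃ = z₄ ∧ z₁ = z₃) := fun h => hA ⟨h.1, h.2.1⟩
      rw [if_pos (Or.inr hB), if_neg hA, if_pos hB, if_neg hC]
      ring
    · have hC : ¬ (z₁ = z₂ ∧ z₃ = z₄ ∧ z₁ = z₃) := fun h => hA ⟨h.1, h.2.1⟩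
      rw [if_neg (not_or.2 ⟨hA, hB⟩), if_neg hA, if_neg hB, if_neg hC]
      ring
  simp only [hsplit, ← Finset.mul_sum]
  congr 1
  simp only [Finset.sum_add_distrib, Finset.sum_sub_distrib]
  -- evaluate the three indicator sums
  have hAsum : ∑ z₁ : QReg N, ∑ z₂ : QReg N, ∑ z₃ : QReg N, ∑ z₄ : QReg N,
      (if z₁ = z₂ ∧ z₃ = z₄ then Φ z₁ * star (Φ z₂) * Φ z₃ * star (Φ z₄) else 0) =
      (∑ z : QReg N, Φ z * star (Φ z)) ^ 2 := by
    rw [pow_two, Finset.sum_mul_sum]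
    refine Finset.sum_congr rfl fun z₁ _ => ?_
    rw [Finset.sum_comm]
    refine Finset.sum_congr rfl fun z₃ _ => ?_
    rw [Finset.sum_eq_single z₁ (fun z₂ _ h => by simp [Ne.symm h]) (by simp)]
    rw [Finset.sum_eq_single z₃ (fun z₄ _ h => by simp [Ne.symm h]) (by simp)]
    simp; ring
  have hBsum : ∑ z₁ : QReg N, ∑ z₂ : QReg N, ∑ z₃ : QReg N, ∑ z₄ : QReg N,
      (if z₁ = z₄ ∧ z₂ = z₃ then Φ z₁ * star (Φ z₂) * Φ z₃ * star (Φ z₄) else 0) =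
      (∑ z : QReg N, Φ z * star (Φ z)) ^ 2 := by
    rw [pow_two, Finset.sum_mul_sum]
    refine Finset.sum_congr rfl fun z₁ _ => Finset.sum_congr rfl fun z₂ _ => ?_
    rw [Finset.sum_eq_single z₂ (fun z₃ _ h => by simp [Ne.symm h]) (by simp)]
    rw [Finset.sum_eq_single z₁ (fun z₄ _ h => by simp [Ne.symm h]) (by simp)]
    simp; ring
  have hCsum : ∑ z₁ : QReg N, ∑ z₂ : QReg N, ∑ z₃ : QReg N, ∑ z₄ : QReg N,
      (if z₁ = z₂ ∧ z₃ = z₄ ∧ z₁ = z₃ then Φ z₁ * star (Φ z₂) * Φ z₃ * star (Φ z₄) else 0) =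
      ∑ z : QReg N, (Φ z * star (Φ z)) ^ 2 := by
    refine Finset.sum_congr rfl fun z₁ _ => ?_
    rw [Finset.sum_eq_single z₁ (fun z₂ _ h => by simp [Ne.symm h]) (by simp)]
    rw [Finset.sum_eq_single z₁ (fun z₃ _ h => by simp [Ne.symm h]) (by simp)]
    rw [Finset.sum_eq_single z₁ (fun z₄ _ h => by simp [Ne.symm h]) (by simp)]
    simp; ring
  rw [hAsum, hBsum, hCsum]
  ring

/-- **Second moment (unbiasedness)**: `Σ_β |T_β(Φ)|² = 2^{N²+2N} Σ_z |Φ(z)|²`.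
[cite: BravyiGosset2016, §II eq. (14) (second moment of the overlap)] -/
theorem sum_normSq_testSum (Φ : QReg N → ℂ) :
    ∑ β : Fin (blockLen N) → Bool, Complex.normSq (testSum Φ β) =
      2 ^ blockLen N * ∑ z : QReg N, Complex.normSq (Φ z) := by
  -- the second moment is the four-phase sum with `z₃ = z₄ = 0`
  have key : ∀ β : Fin (blockLen N) → Bool, (Complex.normSq (testSum Φ β) : ℂ) =
      ∑ z₁ : QReg N, ∑ z₂ : QReg N, fourPhase β z₁ z₂ (fun _ => false) (fun _ => false) *
        (Φ z₁ * star (Φ z₂)) := by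
    intro β
    rw [← Complex.mul_conj, ← Complex.star_def]
    unfold testSum fourPhase
    rw [star_sum, Finset.sum_mul_sum]
    refine Finset.sum_congr rfl fun z₁ _ => Finset.sum_congr rfl fun z₂ _ => ?_
    rw [star_mul, cc_zero, star_one, mul_one, mul_one]
    ring
  apply Complex.ofReal_injective
  push_cast
  simp only [key]
  rw [Finset.sum_comm]
  simp only [Finset.sum_comm (s := (Finset.univ : Finset (Fin (blockLen N) → Bool))), ← Finset.sum_mul,
    sum_fourPhase]
  have hcond : ∀ z₁ z₂ : QReg N, PairCond z₁ z₂ (fun _ => false) (fun _ => false) ↔ z₁ = z₂ := by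
    intro z₁ z₂
    unfold PairCond
    constructor
    · rintro (⟨h, -⟩ | ⟨h1, h2⟩)
      · exact h
      · rw [h1, h2]
    · intro h; exact Or.inl ⟨h, rfl⟩
  simp only [if_congr (hcond _ _) rfl rfl, ite_mul, zero_mul, Finset.mul_sum]
  refine Finset.sum_congr rfl fun z₁ _ => ?_
  rw [Finset.sum_eq_single z₁ (fun z₂ _ h => by simp [Ne.symm h]) (by simp)]
  simp only [if_true, ← Complex.mul_conj, ← Complex.star_def]

/-- **Fourth moment, as an equality of reals**:
`Σ_β |T_β(Φ)|⁴ = 2^{N²+2N} (2 (Σ_z |Φ z|²)² − Σ_z |Φ z|⁴)`. [cite: BravyiGosset2016, §II eq. (14)] -/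
theorem sum_normSq_sq_testSum_eq (Φ : QReg N → ℂ) :
    ∑ β : Fin (blockLen N) → Bool, Complex.normSq (testSum Φ β) ^ 2 =
      2 ^ blockLen N * (2 * (∑ z : QReg N, Complex.normSq (Φ z)) ^ 2 - ∑ z : QReg N, Complex.normSq (Φ z) ^ 2) := by
  apply Complex.ofReal_injective
  push_cast
  have h := sum_testSum_mul_star_sq Φ
  simp only [Complex.star_def, Complex.mul_conj] at h
  exact h

/-- **Fourth moment bound**: `Σ_β |T_β(Φ)|⁴ ≤ 2^{N²+2N} · 2 (Σ_z |Φ(z)|²)²` — the relative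
variance of `|T_β|²` is at most `1`, as for a `2`-design. [cite: BravyiGosset2016, §II eq. (14)–(16)] -/
theorem sum_normSq_sq_testSum_le (Φ : QReg N → ℂ) :
    ∑ β : Fin (blockLen N) → Bool, Complex.normSq (testSum Φ β) ^ 2 ≤
      2 ^ blockLen N * (2 * (∑ z : QReg N, Complex.normSq (Φ z)) ^ 2) := by
  rw [sum_normSq_sq_testSum_eq]
  have h4 : 0 ≤ ∑ z : QReg N, Complex.normSq (Φ z) ^ 2 := Finset.sum_nonneg fun z _ => by positivity
  have h2 : (0 : ℝ) ≤ 2 ^ blockLen N := by positivity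
  nlinarith

end Literature.Computability.QuantumComplexity.BravyiGosset

end
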